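import Summits.QuantumFields.YangMills.Theorems.UnitScaleTiltHalvingP1FlatCoreFrameLinRealLocal
import Literature.MathematicalPhysics.QuantumFieldTheory.Balaban1983to89.B8TraceLogProduct
import HarnessLib

/-!
# The effective-gauge tower in log coordinates: the TRACE row `τ(C(μ)) = 0` for `τ`-free `μ` (J-N05♭ `core′`, induction brick F5 = row (τ-1))

Sub-problem `YangMills` of summit `QuantumFields`; route `UnitScaleTilt`, line H = `BirthV10.stub_halvingStep`, pillar P1♭ `core′`
(LEAD-H BOARD v2 «H = hSupU», RULING L-10: the `[R-f]`-TRACELESS gap, τ-thread (τ-1) ∥ (τ-2) → (τ-3)).  Helper file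
(`--supports stmt-QuantumFields-19200 --as helper`); it closes no item.
HONEST LABEL: YM₃ on `T³` is rung R3 of the ladder, NOT the Clay problem; nothing here is a mass-gap statement.

## What this file adds

The sibling of the reality row ✓`P1FlatCoreFrameLinRealLocal.Cnl_negStar_local` (`C(−μ⋆) = −C(μ)⋆`) for the TRACE: for every continuous
`ℂ`-linear TRACIAL functional `τ` (`τ(xy) = τ(yx)` — the letters of the lit trace-free thread ✓`B8Prop5JoinSectELocalRDTraceFree`, no
determinant) and every `τ`-free bottom datum `μ` (`τ(μ z) = 0`), the nonlinear part `C(μ) := log κ_k[μ](y) − (Q′_k μ)(y)` of the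
effective-gauge tower of the double-bar tower of `W` is `τ`-free, `τ(C(μ)) = 0`, provided the centre stairs of the `U̿^{(i)}W` are
`τ`-free in the logarithm (`τ(log W(Γ)) = 0` — at `M₂(ℂ)`, `τ = tr`, this is `det W(Γ) = 1`, lit ✓`BlockAveragingExpMeanLog.trace_mlog_eq_zero_of_det_eq_one`)
and everything is within `1/24` of `1` (so that every logarithm met is the series (21) and lit ✓`B8TraceLogProduct.apply_mlog_exp_mul_exp`
applies).  Mechanism: by ✓`P1FlatCoreFrameLinTower.effGauge_step_eq_eml` each step of the recursion is a THREE-FACTOR EXPONENTIAL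
`κ_{i+1}(y) = e^{log κ_i(ȳ)}·e^{−M′}·e^{M_H}` whose exponents are means of logarithms of products of `τ`-free-log units; `τ(log(eᵃeᵇeᶜ)) = τa + τb + τc`
(§2) and `τ` kills real-weight means (§1), so `τ(log κ_{i+1}(y)) = 0` by induction (§3); `Q′_k` is a real-weight average (§1), whence §4
★★★ `Cnl_trace_zero_local` — the `Cfam k` TRACE ROW in torus letters, on the same local site family `S` as the reality row.  §5: the disc
suppliers at radius `1/24` (pattern of ✓`P1FlatCoreFrameLinReal` §5).

[cite: Balaban1985RegularSpaces, (1.17) p.78 («𝔤-valued»), Sect. E (1.111), (1.116) pp.95-96; Balaban1985Averaging, (28)-(33) pp.22-23, (97)-(100) p.32, (110) p.34]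
-/

noncomputable section

open NormedSpace
open Literature.MathematicalPhysics.QuantumFieldTheory.Balaban1983to89
open T4Continuum BlockAveraging ExpMeanLog MatrixLog
open B10Eq27TorusAxialLog (holT gaugeActT)
open B7TransferAnalyticMean (meanCLM meanCLM_apply)
open B7Prop1Explicit (units_val_inv_eq_exp_neg)
open B7Eq38Remainder (norm_exp_mul_exp_sub_one_le)
open B8TraceLogProduct (apply_mlog_exp_mul_exp)
open LatticeFieldCalculus (siteAvg siteAvgIter)
open Summit.QuantumFields.YangMills.Theorems.Prop8ChartDoubleBar (vframeU dbarIterU)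
open Summit.QuantumFields.YangMills.Theorems.P1FlatCoreFrameLin (coe_vframeU_eq_exp_meanCLM)
open Summit.QuantumFields.YangMills.Theorems.P1FlatCoreFrameLinTower (effGauge_step_eq_eml)
open Summit.QuantumFields.YangMills.Theorems.P1FlatCoreFrameLinLipschitz (val_unit_eml val_inv_unit_eml)
open Summit.QuantumFields.YangMills.Theorems.P1FlatCoreFrameLinBCH (norm_meanCLM_le_of_forall_le)

namespace Summit.QuantumFields.YangMills.Theorems.P1FlatCoreFrameLinTrace

variable {𝔸 : Type*} [CStarAlgebra 𝔸]

/-! ## §1 A `ℂ`-linear functional kills real-weight means of null data -/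

section Means

/-- `τ(mean f) = 0` when every `τ(f i) = 0` (`mean = |I|⁻¹ Σ`). [folklore] -/
theorem apply_meanCLM_eq_zero {ι : Type*} [Fintype ι] (τ : 𝔸 →L[ℂ] ℂ) {f : ι → 𝔸} (h : ∀ i, τ (f i) = 0) :
    τ (meanCLM ι 𝔸 f) = 0 := by
  rw [meanCLM_apply, map_smul, map_sum]
  simp [h]

variable {P : Params}

/-- `τ(Q′ μ (y)) = 0` for the block site-average of `τ`-null data (real weights `L^{−d}`). [cite: Balaban1984PropagatorsI, (1.20) p.20] -/
theorem apply_siteAvg_eq_zero {j : ℕ} (τ : 𝔸 →L[ℂ] ℂ) {μ : Site P j → 𝔸} (h : ∀ z, τ (μ z) = 0) (y : Site P (j + 1)) :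
    τ (siteAvg μ y) = 0 := by
  simp only [LatticeFieldCalculus.siteAvg, ContinuousLinearMap.map_smul_of_tower, map_sum, h, Finset.sum_const_zero, smul_zero]

/-- `τ(Q′_j μ (y)) = 0` for the ITERATED block site-average of `τ`-null data. [cite: Balaban1984PropagatorsI, (1.20) p.20] -/
theorem apply_siteAvgIter_eq_zero (τ : 𝔸 →L[ℂ] ℂ) (μ : Site P 0 → 𝔸) (h : ∀ z, τ (μ z) = 0) :
    ∀ (j : ℕ) (y : Site P j), τ (siteAvgIter j μ y) = 0
  | 0, y => h y
  | j + 1, y => by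
    show τ (siteAvg (siteAvgIter j μ) y) = 0
    exact apply_siteAvg_eq_zero τ (fun z => apply_siteAvgIter_eq_zero τ μ h j z) y

end Means

/-! ## §2 `τ(log(eᵃeᵇeᶜ)) = τa + τb + τc` -/

section Triple

/-- `e^{1/6} − 1 ≤ 5/24`. [folklore] -/
theorem exp_sixth_sub_one_le : Real.exp (1 / 6 : ℝ) - 1 ≤ 5 / 24 := by
  have h := Real.abs_exp_sub_one_sub_id_le (x := (1 / 6 : ℝ)) (by rw [abs_of_nonneg (by norm_num)]; norm_num)
  have h' := (abs_le.mp h).2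
  nlinarith [h']

/-- **★ `τ(log(eᵃeᵇeᶜ)) = τ(a) + τ(b) + τ(c)`** for a continuous tracial `τ` and `‖a‖, ‖b‖, ‖c‖ ≤ 1/12`: twice lit
✓`B8TraceLogProduct.apply_mlog_exp_mul_exp` (`eᵃeᵇ = e^{d}`, `d := log(eᵃeᵇ)`, `‖d‖ ≤ 2(e^{1/6} − 1) ≤ 5/12`, `τ d = τa + τb`; then
`τ(log(e^{d}eᶜ)) = τ d + τ c` as `‖d‖ + ‖c‖ ≤ ½`). [cite: Balaban1985Averaging, (28)-(33) pp.22-23] -/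
theorem apply_mlog_exp_mul_exp_mul_exp (τ : 𝔸 →L[ℂ] ℂ) (hτ : ∀ x y : 𝔸, τ (x * y) = τ (y * x)) {a b c : 𝔸}
    (ha : ‖a‖ ≤ 1 / 12) (hb : ‖b‖ ≤ 1 / 12) (hc : ‖c‖ ≤ 1 / 12) :
    τ (mlog (exp a * exp b * exp c)) = τ a + τ b + τ c := by
  have h1 : ‖exp a * exp b - 1‖ ≤ 5 / 24 := by
    refine (norm_exp_mul_exp_sub_one_le a b).trans ?_
    calc Real.exp (‖a‖ + ‖b‖) - 1 ≤ Real.exp (1 / 6) - 1 := by gcongr; linarith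
      _ ≤ 5 / 24 := exp_sixth_sub_one_le
  have h1' : ‖exp a * exp b - 1‖ < 1 := h1.trans_lt (by norm_num)
  have hed : exp (mlog (exp a * exp b)) = exp a * exp b := exp_mlog h1'
  have hdn : ‖mlog (exp a * exp b)‖ ≤ 5 / 12 := (norm_mlog_le_two_mul (h1.trans (by norm_num))).trans (by linarith)
  have hτd : τ (mlog (exp a * exp b)) = τ a + τ b := apply_mlog_exp_mul_exp τ hτ (by linarith)
  rw [← hed, apply_mlog_exp_mul_exp τ hτ (by linarith), hτd]

end Triple

/-! ## §3 The tower of a `τ`-free datum has `τ`-free logarithms (LOCAL) -/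

section Tower

variable {P : Params}

/-- **★★ THE EFFECTIVE-GAUGE TOWER OF A `τ`-FREE DATUM IS `τ`-FREE IN THE LOGARITHM, LOCAL**: for a tower-valued function `κf` of the
bottom gauge obeying the recursion of ✓`exists_effGauge` for the double-bar tower of `W` with `κf m 0 = exp ∘ m`, a continuous
tracial `τ`, a `τ`-free datum `μ` (`τ(μ z) = 0`) of size `< log 2` on `S 0`, and a family of site sets `S j` closed under «centre and
stair ends of a block of `S (j+1)` lie in `S j`»: if for the blocks of `S (i+1)`, `i < k`, every centre stair `W(Γ)` of `U̿^{(i)}W` has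
`τ(log W(Γ)) = 0` and is within `1/24` of `1`, every `κ_i(x)`, `x ∈ S i`, is within `1/24` of `1`, and every stair-relative factor
`W(Γ)·κ_i(x_Γ)⁻¹κ_i(ȳ)` is within `1/24` of `1`, then `τ(log κ_i(x)) = 0` for all `i ≤ k`, `x ∈ S i` — level by level through
✓`effGauge_step_eq_eml` (`κ_{i+1}(y) = e^{log κ_i(ȳ)}·e^{−M′}·e^{M_H}`, §2, §1).
[cite: Balaban1985RegularSpaces, (1.17) p.78, Sect. E (1.111), (1.116) pp.95-96; Balaban1985Averaging, (28)-(33) pp.22-23, (97)-(100) p.32, (110) p.34] -/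
theorem apply_mlog_effGauge_eq_zero_local (W : GaugeField P 0 𝔸ˣ) (κf : (Site P 0 → 𝔸) → (i : ℕ) → GaugeTransf P i 𝔸ˣ)
    (hs : ∀ (m : Site P 0 → 𝔸) (i : ℕ) (y : Site P (i + 1)),
      κf m (i + 1) y = (vframeU (gaugeActT (κf m i) (dbarIterU i W)) y)⁻¹ * κf m i (emb y) * vframeU (dbarIterU i W) y)
    (h0 : ∀ (m : Site P 0 → 𝔸) (x : Site P 0), ((κf m 0 x : 𝔸ˣ) : 𝔸) = exp (m x))
    (μ : Site P 0 → 𝔸) (k : ℕ) (S : (j : ℕ) → Set (Site P j))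
    (hSe : ∀ j < k, ∀ y ∈ S (j + 1), emb y ∈ S j)
    (hSs : ∀ j < k, ∀ y ∈ S (j + 1), ∀ idx : Idx P, walkEnd (emb y) (stairWord idx.2.1 (off idx.1)) ∈ S j)
    (τ : 𝔸 →L[ℂ] ℂ) (hτ : ∀ x y : 𝔸, τ (x * y) = τ (y * x))
    (hμ : ∀ z, τ (μ z) = 0) (hμs : ∀ x ∈ S 0, ‖μ x‖ < Real.log 2)
    (hWτ : ∀ i < k, ∀ y ∈ S (i + 1), ∀ idx : Idx P,
      τ (mlog ((holT (dbarIterU i W) (emb y) (stairWord idx.2.1 (off idx.1)) : 𝔸ˣ) : 𝔸)) = 0)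
    (hWs : ∀ i < k, ∀ y ∈ S (i + 1), ∀ idx : Idx P,
      ‖((holT (dbarIterU i W) (emb y) (stairWord idx.2.1 (off idx.1)) : 𝔸ˣ) : 𝔸) - 1‖ ≤ 1 / 24)
    (hκ : ∀ i < k, ∀ x ∈ S i, ‖((κf μ i x : 𝔸ˣ) : 𝔸) - 1‖ ≤ 1 / 24)
    (hdisc : ∀ i < k, ∀ y ∈ S (i + 1), ∀ idx : Idx P,
      ‖((holT (dbarIterU i W) (emb y) (stairWord idx.2.1 (off idx.1)) *
          ((κf μ i (walkEnd (emb y) (stairWord idx.2.1 (off idx.1))))⁻¹ * κf μ i (emb y)) : 𝔸ˣ) : 𝔸) - 1‖ ≤ 1 / 24) :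
    ∀ i ≤ k, ∀ x ∈ S i, τ (mlog ((κf μ i x : 𝔸ˣ) : 𝔸)) = 0 := by
  intro i
  induction i with
  | zero =>
    intro _ x hx
    rw [h0, B7BlockAvgLog.mlog_exp (hμs x hx)]
    exact hμ x
  | succ i ih =>
    intro hik y hy
    have hi : i < k := Nat.lt_of_succ_le hik
    have ihi := ih hi.le
    have hye : emb y ∈ S i := hSe i hi y hy
    have hys : ∀ idx : Idx P, walkEnd (emb y) (stairWord idx.2.1 (off idx.1)) ∈ S i := hSs i hi y hy
    -- sizes of the logarithms met
    have hln : ∀ x ∈ S i, ‖mlog ((κf μ i x : 𝔸ˣ) : 𝔸)‖ ≤ 1 / 12 := fun x hx =>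
      (norm_mlog_le_two_mul ((hκ i hi x hx).trans (by norm_num))).trans (by linarith [hκ i hi x hx])
    have hHn : ∀ idx : Idx P, ‖mlog ((holT (dbarIterU i W) (emb y) (stairWord idx.2.1 (off idx.1)) : 𝔸ˣ) : 𝔸)‖ ≤ 1 / 12 :=
      fun idx => (norm_mlog_le_two_mul ((hWs i hi y hy idx).trans (by norm_num))).trans (by linarith [hWs i hi y hy idx])
    have hRn : ∀ idx : Idx P, ‖mlog (((holT (dbarIterU i W) (emb y) (stairWord idx.2.1 (off idx.1)) : 𝔸ˣ) : 𝔸) *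
        (((κf μ i (walkEnd (emb y) (stairWord idx.2.1 (off idx.1))))⁻¹ * κf μ i (emb y) : 𝔸ˣ) : 𝔸))‖ ≤ 1 / 12 := by
      intro idx
      have h := hdisc i hi y hy idx
      rw [Units.val_mul] at h
      exact (norm_mlog_le_two_mul (h.trans (by norm_num))).trans (by linarith)
    -- the two means of logarithms
    have hM'n : ‖meanCLM (Idx P) 𝔸 (fun idx : Idx P => mlog (((holT (dbarIterU i W) (emb y) (stairWord idx.2.1 (off idx.1)) : 𝔸ˣ) : 𝔸) *
        (((κf μ i (walkEnd (emb y) (stairWord idx.2.1 (off idx.1))))⁻¹ * κf μ i (emb y) : 𝔸ˣ) : 𝔸)))‖ ≤ 1 / 12 :=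
      norm_meanCLM_le_of_forall_le _ (by norm_num) hRn
    have hMHn : ‖meanCLM (Idx P) 𝔸 (fun idx : Idx P =>
        mlog ((holT (dbarIterU i W) (emb y) (stairWord idx.2.1 (off idx.1)) : 𝔸ˣ) : 𝔸))‖ ≤ 1 / 12 :=
      norm_meanCLM_le_of_forall_le _ (by norm_num) hHn
    -- their traces vanish
    have hMHτ : τ (meanCLM (Idx P) 𝔸 (fun idx : Idx P =>
        mlog ((holT (dbarIterU i W) (emb y) (stairWord idx.2.1 (off idx.1)) : 𝔸ˣ) : 𝔸))) = 0 :=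
      apply_meanCLM_eq_zero τ fun idx => hWτ i hi y hy idx
    have hM'τ : τ (meanCLM (Idx P) 𝔸 (fun idx : Idx P => mlog (((holT (dbarIterU i W) (emb y) (stairWord idx.2.1 (off idx.1)) : 𝔸ˣ) : 𝔸) *
        (((κf μ i (walkEnd (emb y) (stairWord idx.2.1 (off idx.1))))⁻¹ * κf μ i (emb y) : 𝔸ˣ) : 𝔸)))) = 0 := by
      refine apply_meanCLM_eq_zero τ fun idx => ?_
      -- the stair-relative factor is a three-factor exponential `e^{log W(Γ)}·e^{−log κ(x_Γ)}·e^{log κ(ȳ)}`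
      have hfac : ((holT (dbarIterU i W) (emb y) (stairWord idx.2.1 (off idx.1)) : 𝔸ˣ) : 𝔸) *
          (((κf μ i (walkEnd (emb y) (stairWord idx.2.1 (off idx.1))))⁻¹ * κf μ i (emb y) : 𝔸ˣ) : 𝔸) =
          exp (mlog ((holT (dbarIterU i W) (emb y) (stairWord idx.2.1 (off idx.1)) : 𝔸ˣ) : 𝔸)) *
            exp (-mlog ((κf μ i (walkEnd (emb y) (stairWord idx.2.1 (off idx.1))) : 𝔸ˣ) : 𝔸)) *
            exp (mlog ((κf μ i (emb y) : 𝔸ˣ) : 𝔸)) := by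
        rw [Units.val_mul, exp_mlog ((hWs i hi y hy idx).trans_lt (by norm_num)),
          units_val_inv_eq_exp_neg (exp_mlog ((hκ i hi _ (hys idx)).trans_lt (by norm_num))).symm,
          exp_mlog ((hκ i hi _ hye).trans_lt (by norm_num)), mul_assoc]
      rw [hfac, apply_mlog_exp_mul_exp_mul_exp τ hτ (hHn idx) (by rw [norm_neg]; exact hln _ (hys idx)) (hln _ hye), map_neg,
        hWτ i hi y hy idx, ihi _ (hys idx), ihi _ hye]
      ring
    -- the step `κ_{i+1}(y) = e^{log κ_i(ȳ)}·e^{−M′}·e^{M_H}`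
    rw [effGauge_step_eq_eml W (κf μ) (hs μ) i y, Units.val_mul, Units.val_mul, val_inv_unit_eml, coe_vframeU_eq_exp_meanCLM,
      ← exp_mlog ((hκ i hi _ hye).trans_lt (by norm_num) : ‖((κf μ i (emb y) : 𝔸ˣ) : 𝔸) - 1‖ < 1),
      apply_mlog_exp_mul_exp_mul_exp τ hτ (hln _ hye) (by rw [norm_neg]; exact hM'n) hMHn, map_neg, ihi _ hye, hM'τ, hMHτ]
    ring

/-! ## §4 The trace row -/

/-- **★★★ THE TRACE ROW `τ(C(μ)) = 0` OF THE EFFECTIVE-GAUGE TOWER, LOCAL** — the `Cfam k` TRACE ROW of the τ-thread (LEAD-H L-10 (τ-1);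
the `hCτ` text of the family-τ socket at the top, in torus letters; sibling of the reality row ✓`Cnl_negStar_local` on the same site family
`S`): under the hypotheses of ✓`apply_mlog_effGauge_eq_zero_local`, for `y ∈ S k` the nonlinear part `C(μ) := log κf(μ)_k(y) − (Q′_k μ)(y)`
has `τ(C(μ)) = 0` — so `C` maps `𝔤`-valued (`τ`-free Hermitian) `λ = iμ`-data to `𝔤`-valued data (print: the gauge parameters are `𝔤`-valued,
[Balaban1985RegularSpaces] (1.17) p.78). [cite: Balaban1985RegularSpaces, (1.17) p.78, Sect. E (1.111), (1.116) pp.95-96; Balaban1985Averaging, (28)-(33) pp.22-23] -/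
theorem Cnl_trace_zero_local (W : GaugeField P 0 𝔸ˣ) (κf : (Site P 0 → 𝔸) → (i : ℕ) → GaugeTransf P i 𝔸ˣ)
    (hs : ∀ (m : Site P 0 → 𝔸) (i : ℕ) (y : Site P (i + 1)),
      κf m (i + 1) y = (vframeU (gaugeActT (κf m i) (dbarIterU i W)) y)⁻¹ * κf m i (emb y) * vframeU (dbarIterU i W) y)
    (h0 : ∀ (m : Site P 0 → 𝔸) (x : Site P 0), ((κf m 0 x : 𝔸ˣ) : 𝔸) = exp (m x))
    (μ : Site P 0 → 𝔸) (k : ℕ) (S : (j : ℕ) → Set (Site P j))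
    (hSe : ∀ j < k, ∀ y ∈ S (j + 1), emb y ∈ S j)
    (hSs : ∀ j < k, ∀ y ∈ S (j + 1), ∀ idx : Idx P, walkEnd (emb y) (stairWord idx.2.1 (off idx.1)) ∈ S j)
    (τ : 𝔸 →L[ℂ] ℂ) (hτ : ∀ x y : 𝔸, τ (x * y) = τ (y * x))
    (hμ : ∀ z, τ (μ z) = 0) (hμs : ∀ x ∈ S 0, ‖μ x‖ < Real.log 2)
    (hWτ : ∀ i < k, ∀ y ∈ S (i + 1), ∀ idx : Idx P,
      τ (mlog ((holT (dbarIterU i W) (emb y) (stairWord idx.2.1 (off idx.1)) : 𝔸ˣ) : 𝔸)) = 0)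
    (hWs : ∀ i < k, ∀ y ∈ S (i + 1), ∀ idx : Idx P,
      ‖((holT (dbarIterU i W) (emb y) (stairWord idx.2.1 (off idx.1)) : 𝔸ˣ) : 𝔸) - 1‖ ≤ 1 / 24)
    (hκ : ∀ i < k, ∀ x ∈ S i, ‖((κf μ i x : 𝔸ˣ) : 𝔸) - 1‖ ≤ 1 / 24)
    (hdisc : ∀ i < k, ∀ y ∈ S (i + 1), ∀ idx : Idx P,
      ‖((holT (dbarIterU i W) (emb y) (stairWord idx.2.1 (off idx.1)) *
          ((κf μ i (walkEnd (emb y) (stairWord idx.2.1 (off idx.1))))⁻¹ * κf μ i (emb y)) : 𝔸ˣ) : 𝔸) - 1‖ ≤ 1 / 24)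
    (y : Site P k) (hy : y ∈ S k) :
    τ (mlog ((κf μ k y : 𝔸ˣ) : 𝔸) - siteAvgIter k μ y) = 0 := by
  rw [map_sub, apply_mlog_effGauge_eq_zero_local W κf hs h0 μ k S hSe hSs τ hτ hμ hμs hWτ hWs hκ hdisc k le_rfl y hy,
    apply_siteAvgIter_eq_zero τ μ hμ k y, sub_zero]

/-- **THE TRACE ROW, GLOBAL** (`S j := univ`): all stairs `τ`-free in the logarithm and within `1/24` of `1`, all `κ_i(x)` (`i < k`) and all
stair-relative factors within `1/24` of `1`, `μ` `τ`-free of size `< log 2` ⇒ `τ(log κf(μ)_k(y) − (Q′_k μ)(y)) = 0` for every `y`.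
[cite: Balaban1985RegularSpaces, (1.17) p.78, Sect. E (1.111), (1.116) pp.95-96] -/
theorem Cnl_trace_zero (W : GaugeField P 0 𝔸ˣ) (κf : (Site P 0 → 𝔸) → (i : ℕ) → GaugeTransf P i 𝔸ˣ)
    (hs : ∀ (m : Site P 0 → 𝔸) (i : ℕ) (y : Site P (i + 1)),
      κf m (i + 1) y = (vframeU (gaugeActT (κf m i) (dbarIterU i W)) y)⁻¹ * κf m i (emb y) * vframeU (dbarIterU i W) y)
    (h0 : ∀ (m : Site P 0 → 𝔸) (x : Site P 0), ((κf m 0 x : 𝔸ˣ) : 𝔸) = exp (m x))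
    (μ : Site P 0 → 𝔸) (k : ℕ) (τ : 𝔸 →L[ℂ] ℂ) (hτ : ∀ x y : 𝔸, τ (x * y) = τ (y * x))
    (hμ : ∀ z, τ (μ z) = 0) (hμs : ∀ x, ‖μ x‖ < Real.log 2)
    (hWτ : ∀ i < k, ∀ (y : Site P (i + 1)) (idx : Idx P),
      τ (mlog ((holT (dbarIterU i W) (emb y) (stairWord idx.2.1 (off idx.1)) : 𝔸ˣ) : 𝔸)) = 0)
    (hWs : ∀ i < k, ∀ (y : Site P (i + 1)) (idx : Idx P),
      ‖((holT (dbarIterU i W) (emb y) (stairWord idx.2.1 (off idx.1)) : 𝔸ˣ) : 𝔸) - 1‖ ≤ 1 / 24)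
    (hκ : ∀ i < k, ∀ x : Site P i, ‖((κf μ i x : 𝔸ˣ) : 𝔸) - 1‖ ≤ 1 / 24)
    (hdisc : ∀ i < k, ∀ (y : Site P (i + 1)) (idx : Idx P),
      ‖((holT (dbarIterU i W) (emb y) (stairWord idx.2.1 (off idx.1)) *
          ((κf μ i (walkEnd (emb y) (stairWord idx.2.1 (off idx.1))))⁻¹ * κf μ i (emb y)) : 𝔸ˣ) : 𝔸) - 1‖ ≤ 1 / 24)
    (y : Site P k) :
    τ (mlog ((κf μ k y : 𝔸ˣ) : 𝔸) - siteAvgIter k μ y) = 0 :=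
  Cnl_trace_zero_local W κf hs h0 μ k (fun _ => Set.univ) (fun _ _ _ _ => Set.mem_univ _) (fun _ _ _ _ _ => Set.mem_univ _) τ hτ hμ
    (fun x _ => hμs x) (fun i hi y _ idx => hWτ i hi y idx) (fun i hi y _ idx => hWs i hi y idx) (fun i hi x _ => hκ i hi x)
    (fun i hi y _ idx => hdisc i hi y idx) y (Set.mem_univ _)

end Tower

/-! ## §5 Discharging the disc conditions at radius `1/24` from the size rows (for the (T4b)∕(τ-3) instance) -/

section Disc

variable {𝔹 : Type*} [NormedRing 𝔹] [NormedAlgebra ℂ 𝔹] [CompleteSpace 𝔹] {P : Params} {j : ℕ}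

open B12Membership313II (bchLog exp_bchLog norm_expMul_sub_one_lt_one norm_exp_mul_exp_sub_one_le_of_le)
open Summit.QuantumFields.YangMills.Theorems.P1FlatCoreFrameLinOsc (norm_bchLog_le_two_mul)

/-- `e^{1/50} − 1 ≤ 1/24`. [folklore] -/
theorem exp_fiftieth_sub_one_le : Real.exp (1 / 50 : ℝ) - 1 ≤ 1 / 24 := by
  have h := Real.abs_exp_sub_one_le (x := (1 / 50 : ℝ)) (by rw [abs_of_nonneg (by norm_num)]; norm_num)
  rw [abs_of_nonneg (by norm_num : (0 : ℝ) ≤ 1 / 50)] at h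
  linarith [le_abs_self (Real.exp (1 / 50 : ℝ) - 1)]

/-- **THE STAIR DISC CONDITION `≤ 1/24` FROM THE SIZE ROW** (pointwise: `κ = e^{l}` AT the two sites `x`, `z` only, `‖l‖ ≤ a″` there), stair `hol` within
`δ ≤ 1/2` of `1`, `2δ + 4a″ ≤ 1/50` ⇒ `‖hol·κ(x)⁻¹κ(z) − 1‖ ≤ 1/24` (the `hdisc` of ✓`apply_mlog_effGauge_eq_zero_local`; pattern of
✓`P1FlatCoreFrameLinReal.norm_stairRel_sub_one_le_twelfth`). [cite: Balaban1985Averaging, (21) p.21, (110) p.34] -/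
theorem norm_stairRel_sub_one_le_24th (hol : 𝔹ˣ) (κ : GaugeTransf P j 𝔹ˣ) (l : Site P j → 𝔹) (x z : Site P j)
    (hκx : ((κ x : 𝔹ˣ) : 𝔹) = exp (l x)) (hκz : ((κ z : 𝔹ˣ) : 𝔹) = exp (l z)) {δ a'' : ℝ} (hH : ‖(hol : 𝔹) - 1‖ ≤ δ)
    (hx : ‖l x‖ ≤ a'') (hz : ‖l z‖ ≤ a'') (hδ : δ ≤ 1 / 2) (hr : 2 * δ + 4 * a'' ≤ 1 / 50) :
    ‖(((hol * ((κ x)⁻¹ * κ z)) : 𝔹ˣ) : 𝔹) - 1‖ ≤ 1 / 24 := by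
  have ha : 0 ≤ a'' := (norm_nonneg _).trans hx
  have hδ0 : 0 ≤ δ := (norm_nonneg _).trans hH
  have h1 : ‖(hol : 𝔹) - 1‖ < 1 := hH.trans_lt (by linarith)
  have hHn : ‖mlog (hol : 𝔹)‖ ≤ 2 * δ := (norm_mlog_le_two_mul (hH.trans hδ)).trans (by linarith)
  have hrel : ((((κ x)⁻¹ * κ z) : 𝔹ˣ) : 𝔹) = exp (-(l x)) * exp (l z) := by
    rw [Units.val_mul, units_val_inv_eq_exp_neg hκx, hκz]
  have h2 : ‖-(l x)‖ + ‖l z‖ ≤ 1 / 4 := by rw [norm_neg]; linarith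
  have hSn : ‖bchLog (-(l x)) (l z)‖ ≤ 2 * (a'' + a'') := norm_bchLog_le_two_mul (by rwa [norm_neg]) hz (by linarith)
  rw [Units.val_mul, hrel, ← exp_bchLog (norm_expMul_sub_one_lt_one h2)]
  conv_lhs => rw [← exp_mlog h1]
  exact (norm_exp_mul_exp_sub_one_le_of_le (s := 1 / 50) (by linarith)).trans exp_fiftieth_sub_one_le

/-- **THE UNIT DISC CONDITION `≤ 1/24`**: `‖l‖ ≤ 1/50 ⇒ ‖e^{l} − 1‖ ≤ 1/24` (the `hκ` of ✓`apply_mlog_effGauge_eq_zero_local` for `κ_i(x) = e^{log κ_i(x)}`,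
and its `hWs` for a stair `W(Γ) = e^{log W(Γ)}`). [folklore] -/
theorem norm_exp_sub_one_le_24th (l : 𝔹) (hl : ‖l‖ ≤ 1 / 50) : ‖exp l - 1‖ ≤ 1 / 24 :=
  (B7Transfer.norm_exp_sub_one_le_of_le l hl).trans exp_fiftieth_sub_one_le

end Disc

end Summit.QuantumFields.YangMills.Theorems.P1FlatCoreFrameLinTrace

end
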